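import Literature.Combinatorics.LorentzianPolynomials.RayleighSupportMConvex
import Literature.Combinatorics.LorentzianPolynomials.LorentzianLogConcave
import HarnessLib

/-!
# Log-concave homogeneous polynomials are Lorentzian: Brändén–Huh's Theorem 2.30 ((1), (2) ⟹ (3)), Prop. 2.33
# ((1), (2) ⟹ (3)), Theorem 2.25's criterion on the open orthant, Corollary 2.31

Layer `Literature/Combinatorics/LorentzianPolynomials`, namespace `Literature.Combinatorics.LorentzianPolynomials`;
lane `lit-hodgefound` (Track 2 foundations library), seat p16, generation 29 (row g29-#3). Completes the circle of
implications of Theorem 2.30 for the tree's Definition-2.6 `lorentzian`, whose forward half ((3) ⟹ (1), (2), in the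
Hessian form of Prop. 2.33) is `LorentzianLogConcave.lean` (row g28-#12). Inputs: Theorem 2.23
(`isMConvex_support_of_isCRayleigh`, row g29-#2), Prop. 2.19 in its conditional form
(`isCRayleigh_of_forall_sigPos_hessianAt_iterPderiv_le_one`, `Rayleigh.lean`), Theorem 2.25's criterion
(`mem_lorentzian_iff_forall_sigPos_hessian`, `Quadratic.lean`), Thm. 2.16 (2)
(`sigPos_hessianAt_iterPderiv_le_one_of_mem_lorentzian`, `HodgeRiemann.lean`) and the signature lemma
`sigPos_le_one_of_orthogonal_nonpos` (Shenfeld–van Handel Lemma 2.9, `LorentzianReverseSchwarz.lean`).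

## Source (verbatim) — P. Brändén, J. Huh, *Lorentzian polynomials* [BrandenHuh2019] (held `paper:arxiv-1902.03719`)

§2.5 (p. 26): "Let `f` be a polynomial in `n` variables with nonnegative coefficients. In [Gur09], Gurvits defines `f`
to be *strongly log-concave* if, for all `α ∈ ℕ^n`, `∂^α f` is identically zero or `log(∂^α f)` is concave on
`ℝ^n_{>0}`. In [AOVI], Anari et al. define `f` to be *completely log-concave* if, for all `m ∈ ℕ` and any `m × n` matrix
`(a_{ij})` with nonnegative entries, `(Π_{i=1}^m D_i) f` is identically zero or `log((Π_{i=1}^m D_i) f)` is concave on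
`ℝ^n_{>0}`, where `D_i` is the differential operator `Σ_{j=1}^n a_{ij} ∂_j`. […] **Theorem 2.30.** The following
conditions are equivalent for any homogeneous polynomial `f`. (1) `f` is completely log-concave. (2) `f` is strongly
log-concave. (3) `f` is Lorentzian. The support of any Lorentzian polynomial is M-convex by Theorem 2.25. Thus, by
Theorem 2.30, the same holds for any strongly log-concave homogeneous polynomial. […] **Corollary 2.31.** The support
of any strongly log-concave homogeneous polynomial is M-convex. […] Let `f` be a homogeneous polynomial in `n ≥ 2`
variables of degree `d ≥ 2`. **Proposition 2.33.** The following are equivalent for any `w ∈ ℝ^n` satisfying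
`f(w) > 0`. (1) The Hessian of `f^{1/d}` is negative semidefinite at `w`. (2) The Hessian of `log f` is negative
semidefinite at `w`. (3) The Hessian of `f` has exactly one positive eigenvalue at `w`. […] *Proof.* […] We have
`d f^{-1/d} 𝓗_1 = 𝓗_2 + (1/d) f^{-2} (grad f)(grad f)^T` and `𝓗_2 = f^{-1} 𝓗_3 - f^{-2} (grad f)(grad f)^T`. Since
`(grad f)(grad f)^T` is positive semidefinite of rank one, Weyl's inequalities for Hermitian matrices show that
`𝓗_2 ≺ 𝓗_1` and `𝓗_2 ≺ 𝓗_3` and `𝓗_1 ≺ 𝓗_3`. Since `w^T 𝓗_3 w = d(d-1) f`, `𝓗_3` has at least one positive eigenvalue,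
and hence (1) ⟹ (2) ⟹ (3). […] It follows that, for any nonzero degree `d ≥ 2` homogeneous polynomial `f` with
nonnegative coefficients, the following conditions are equivalent: – The function `f^{1/d}` is concave on `ℝ^n_{>0}`.
– The function `log f` is concave on `ℝ^n_{>0}`. – The Hessian of `f` has exactly one positive eigenvalue on
`ℝ^n_{>0}`. *Proof of Theorem 2.30.* We may suppose that `f` has degree `d ≥ 2`. Clearly, completely log-concave
polynomials are strongly log-concave. Suppose `f` is a strongly log-concave homogeneous polynomial of degree `d`. By
Proposition 2.33, either `∂^α f` is identically zero or the Hessian of `∂^α f` has exactly one positive eigenvalue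
on `ℝ^n_{>0}` for all `α ∈ ℕ^n`. By Proposition 2.17, `f` is `2(1 - 1/d)`-Rayleigh, and hence, by Theorem 2.23, the
support of `f` is M-convex. Therefore, by Theorem 2.25, `f` is Lorentzian."
§2.4 (p. 24): "**Theorem 2.25.** […] Therefore, a degree `d` homogeneous polynomial `f` with nonnegative coefficients
is Lorentzian if and only if the support of `f` is M-convex and `∂^α f` has at most one positive eigenvalue for
every `α ∈ Δ^{d-2}_n`."

As in `LorentzianLogConcave.lean`, negative semidefiniteness of the Hessian of `log g` at `w` (`g(w) > 0`) is written
out as `g(w) · xᵀ H_g(w) x ≤ (∇g(w)·x)²` for all `x`, and that of `g^{1/d}` as `g(w) · xᵀ H_g(w) x ≤ (1 - 1/d)(∇g(w)·x)²`;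
"exactly/at most one positive eigenvalue" is `sigPos ≤ 1` of `z ↦ zᵀ H z`.

## What is here

* §1 **Prop. 2.33, (2) ⟹ (3) and (1) ⟹ (3), pointwise** (`sigPos_hessianAt_le_one_of_logConcaveAt`, `…_of_rootConcaveAt`):
  the kernel of `x ↦ ∇f(w)·x = xᵀ H_f(w) w/(d-1)` (Euler) is a hyperplane on which `H_f(w)` is nonpositive, so
  `sigPos ≤ 1` (the rank-one/Weyl step of the source, via `sigPos_le_one_of_orthogonal_nonpos`); with
  `wᵀ H w = d(d-1) f(w) > 0`, "exactly one".
* §2 **Theorem 2.25's criterion on the open orthant / the heart of Thm. 2.30 (2) ⟹ (3)**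
  (`mem_lorentzian_of_forall_sigPos_hessianAt_le_one`, `mem_lorentzian_iff_forall_sigPos_hessianAt_le_one`): a
  homogeneous `f` with nonnegative coefficients is Lorentzian iff every `H_{∂^α f}(w)`, `|α| ≤ d - 2`, `w ∈ ℝ^n_{>0}`, has
  at most one positive eigenvalue — Prop. 2.19 (conditional form) makes `f` `2(1 - 1/d)`-Rayleigh, Theorem 2.23 makes
  `supp f` M-convex, and the Hessians of the quadratics `∂^α f`, `|α| = d - 2`, are constant, so Theorem 2.25 applies.
* §3 **Theorem 2.30, (2) ⟹ (3)** (`mem_lorentzian_of_stronglyLogConcave`, Hessian form on `ℝ^n_{>0}`; an `∂^α f ≠ 0`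
  with nonnegative coefficients is positive on `ℝ^n_{>0}`), the equivalence `mem_lorentzian_iff_stronglyLogConcave`,
  and **Corollary 2.31** `isMConvex_support_of_stronglyLogConcave`.
* §4 **Theorem 2.30, (1) ⟹ (3)** (`mem_lorentzian_of_completelyLogConcave`: `∂^α = D_{e_{i_1}} ⋯ D_{e_{i_|α|}}`,
  "completely log-concave polynomials are strongly log-concave"), `foldr_dirDeriv_eq_zero_of_lt` (more than `d`
  directional derivatives kill a form of degree `d`) and the equivalence `mem_lorentzian_iff_completelyLogConcave`
  without a length guard.

Theorems only; no definition, no `sorry`, no named fact (net debt 0). The passage between these Hessian inequalities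
and concavity of `log g` / `g^{1/d}` as real functions on `ℝ^n_{>0}` is standard calculus and is not repeated here.

## References

* [BrandenHuh2019] P. Brändén, J. Huh, *Lorentzian polynomials*, Ann. of Math. (2) 192 (2020) 821–891, arXiv:1902.03719 —
  §2.5 Thm. 2.30, Cor. 2.31, Prop. 2.33 (pp. 26–28); §2.4 Thm. 2.25 (p. 24), Thm. 2.23, Prop. 2.19; §2.3 Thm. 2.16 (2).
* [ShenfeldVanHandel2019] Y. Shenfeld, R. van Handel, *Mixed volumes and the Bochner method*, Proc. AMS 147 (2019) —
  Lemma 2.9, via `Literature.LinearAlgebra.QuadraticForm.LorentzianReverseSchwarz`.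
-/

noncomputable section

open MvPolynomial Finsupp Finset
open Literature.LinearAlgebra.QuadraticForm

namespace Literature.Combinatorics.LorentzianPolynomials

variable {σ : Type*} [Fintype σ] [DecidableEq σ]

/-! ## §1 Proposition 2.33, (2) ⟹ (3) and (1) ⟹ (3), at a point -/

section Prop233

/-- **Proposition 2.33, (2) ⟹ (3), pointwise.** Let `f` be homogeneous of degree `d ≥ 2` and `w ∈ ℝ^n` with
`f(w) > 0`. If the Hessian of `log f` is negative semidefinite at `w` — `f(w) · xᵀ H_f(w) x ≤ (∇f(w)·x)²` for all `x` —
then `H_f(w)` has at most one positive eigenvalue: by Euler `xᵀ H_f(w) w = (d-1) ∇f(w)·x`, so `H_f(w)` is nonpositive on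
the hyperplane `w^⊥ = ker(∇f(w)·)` ("`𝓗_2 = f^{-1} 𝓗_3 - f^{-2} (grad f)(grad f)^T` […] `𝓗_2 ≺ 𝓗_3`").
[cite: BrandenHuh2019, §2.5 Prop. 2.33 ((2) ⟹ (3)) and its proof (pp. 27–28)] [cite: ShenfeldVanHandel2019, Lemma 2.9] -/
theorem sigPos_hessianAt_le_one_of_logConcaveAt {f : MvPolynomial σ ℝ} {d : ℕ} (hf : f.IsHomogeneous d) (hd : 2 ≤ d)
    {w : σ → ℝ} (hfw : 0 < eval w f)
    (hlog : ∀ x : σ → ℝ, eval w f * Matrix.toBilin' (hessianAt f w) x x ≤ (∑ i, x i * eval w (pderiv i f)) ^ 2) :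
    sigPos (Matrix.toBilin' (hessianAt f w)).toQuadraticMap ≤ 1 := by
  refine sigPos_le_one_of_orthogonal_nonpos _ (w := w) fun z hz ↦ ?_
  rw [toBilin'_hessianAt_right_self hf w z] at hz
  have hd1 : ((d - 1 : ℕ) : ℝ) ≠ 0 := by
    have : 1 ≤ d - 1 := by omega
    positivity
  have hsum : ∑ i, z i * eval w (pderiv i f) = 0 := by
    rcases mul_eq_zero.1 hz with h | h
    · exact absurd h hd1
    · exact h
  have h := hlog z
  rw [hsum, sq, mul_zero] at h
  by_contra hpos
  exact absurd h (not_le.2 (mul_pos hfw (not_le.1 hpos)))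

/-- **Proposition 2.33, (1) ⟹ (3), pointwise**: if the Hessian of `f^{1/d}` is negative semidefinite at `w` —
`f(w) · xᵀ H_f(w) x ≤ (1 - 1/d)(∇f(w)·x)²` for all `x` — then `H_f(w)` has at most one positive eigenvalue
("(1) ⟹ (2) ⟹ (3)"). [cite: BrandenHuh2019, §2.5 Prop. 2.33 ((1) ⟹ (3)) (p. 27)] -/
theorem sigPos_hessianAt_le_one_of_rootConcaveAt {f : MvPolynomial σ ℝ} {d : ℕ} (hf : f.IsHomogeneous d) (hd : 2 ≤ d)
    {w : σ → ℝ} (hfw : 0 < eval w f)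
    (hroot : ∀ x : σ → ℝ, eval w f * Matrix.toBilin' (hessianAt f w) x x ≤
      (1 - 1 / (d : ℝ)) * (∑ i, x i * eval w (pderiv i f)) ^ 2) :
    sigPos (Matrix.toBilin' (hessianAt f w)).toQuadraticMap ≤ 1 := by
  refine sigPos_hessianAt_le_one_of_logConcaveAt hf hd hfw fun x ↦ (hroot x).trans ?_
  have hdpos : (0 : ℝ) < d := by exact_mod_cast (show 0 < d by omega)
  have h : 1 - 1 / (d : ℝ) ≤ 1 := by
    have : 0 ≤ 1 / (d : ℝ) := by positivity
    linarith
  exact (mul_le_mul_of_nonneg_right h (sq_nonneg _)).trans (by rw [one_mul])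

/-- "Since `w^T 𝓗_3 w = d(d-1) f`, `𝓗_3` has at least one positive eigenvalue": with `f(w) > 0` the conclusion of Prop.
2.33 (3) is "exactly one positive eigenvalue", `sigPos H_f(w) = 1`. [cite: BrandenHuh2019, §2.5 proof of Prop. 2.33
(p. 28)] -/
theorem sigPos_hessianAt_eq_one_of_logConcaveAt {f : MvPolynomial σ ℝ} {d : ℕ} (hf : f.IsHomogeneous d) (hd : 2 ≤ d)
    {w : σ → ℝ} (hfw : 0 < eval w f)
    (hlog : ∀ x : σ → ℝ, eval w f * Matrix.toBilin' (hessianAt f w) x x ≤ (∑ i, x i * eval w (pderiv i f)) ^ 2) :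
    sigPos (Matrix.toBilin' (hessianAt f w)).toQuadraticMap = 1 := by
  refine le_antisymm (sigPos_hessianAt_le_one_of_logConcaveAt hf hd hfw hlog)
    (one_le_sigPos_of_self_pos _ (w := w) ?_)
  rw [toBilin'_hessianAt_self hf w]
  have hd1 : (0 : ℝ) < ((d - 1 : ℕ) : ℝ) := by
    have : 1 ≤ d - 1 := by omega
    positivity
  have hdpos : (0 : ℝ) < d := by exact_mod_cast (show 0 < d by omega)
  positivity

end Prop233

/-! ## §2 Theorem 2.25's criterion on the open orthant -/

section Criterion

omit [DecidableEq σ] in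
/-- A nonzero polynomial with nonnegative coefficients is positive on the open orthant `ℝ^n_{>0}` ("`∂^α f` is
identically zero or …"). [cite: BrandenHuh2019, §2.5 Thm. 2.30 (the dichotomy "identically zero or `log` concave on
`ℝ^n_{>0}`")] -/
theorem eval_pos_of_ne_zero_of_coeff_nonneg {g : MvPolynomial σ ℝ} (hg : g ≠ 0) (hnn : ∀ β, 0 ≤ coeff β g)
    {w : σ → ℝ} (hw : ∀ k, 0 < w k) : 0 < eval w g := by
  obtain ⟨δ, hδ⟩ : ∃ δ, coeff δ g ≠ 0 := by
    by_contra hno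
    apply hg
    ext δ
    rw [coeff_zero]
    by_contra h
    exact hno ⟨δ, h⟩
  have h := coeff_mul_prod_pow_le_eval hnn (fun k ↦ (hw k).le) δ
  exact lt_of_lt_of_le (mul_pos (lt_of_le_of_ne (hnn δ) (Ne.symm hδ))
    (Finset.prod_pos fun k _ ↦ pow_pos (hw k) _)) h

/-- **Theorem 2.25's criterion with the Hessians read on the open orthant** (the heart of Thm. 2.30 (2) ⟹ (3)): a
homogeneous polynomial `f` of degree `d` with nonnegative coefficients such that `H_{∂^α f}(w)` has at most one positive
eigenvalue for every `|α| ≤ d - 2` and every `w ∈ ℝ^n_{>0}` is Lorentzian. "By Proposition 2.17, `f` is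
`2(1 - 1/d)`-Rayleigh, and hence, by Theorem 2.23, the support of `f` is M-convex. Therefore, by Theorem 2.25, `f` is
Lorentzian" (the Hessian of the quadratic `∂^α f`, `|α| = d - 2`, is constant, so its value at `𝟙 ∈ ℝ^n_{>0}` is the
one Theorem 2.25 asks about). [cite: BrandenHuh2019, §2.5 proof of Thm. 2.30 (p. 28); §2.4 Thm. 2.25 (p. 24), Thm. 2.23,
Prop. 2.19] -/
theorem mem_lorentzian_of_forall_sigPos_hessianAt_le_one {f : MvPolynomial σ ℝ} {d : ℕ} (hf : f.IsHomogeneous d)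
    (hnn : ∀ α, 0 ≤ coeff α f)
    (hH : ∀ α : σ →₀ ℕ, α.degree + 2 ≤ d → ∀ w : σ → ℝ, (∀ k, 0 < w k) →
      sigPos (Matrix.toBilin' (hessianAt (iterPderiv α f) w)).toQuadraticMap ≤ 1) :
    f ∈ lorentzian σ d := by
  -- Prop. 2.19 and Theorem 2.23: the support of `f` is M-convex
  have hM : IsMConvex {α | coeff α f ≠ 0} :=
    isMConvex_support_of_isCRayleigh (isCRayleigh_of_forall_sigPos_hessianAt_iterPderiv_le_one hf hnn hH) hf
  -- Theorem 2.25 (criterion)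
  rcases Nat.lt_or_ge d 2 with hd | hd
  · interval_cases d
    · exact mem_lorentzian_zero.2 ⟨hf, hnn⟩
    · exact mem_lorentzian_one.2 ⟨hf, hnn⟩
  · obtain ⟨m, rfl⟩ : ∃ m, d = m + 2 := ⟨d - 2, by omega⟩
    refine mem_lorentzian_iff_forall_sigPos_hessian.2 ⟨⟨hf, hnn, hM⟩, fun α hα ↦ ?_⟩
    have hf' : f.IsHomogeneous (2 + α.degree) := by rw [hα, add_comm]; exact hf
    have hq : (iterPderiv α f).IsHomogeneous 2 := IsHomogeneous.iterPderiv α hf'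
    rw [← hessianAt_eq_hessian hq (fun _ ↦ (1 : ℝ))]
    exact hH α (by rw [hα, add_comm]) (fun _ ↦ 1) fun _ ↦ one_pos

/-- **Lorentzian ⟺ all Hessians `H_{∂^α f}(w)`, `w ∈ ℝ^n_{>0}`, have at most one positive eigenvalue** (for `f`
homogeneous with nonnegative coefficients): Theorem 2.16 (2) one way, Theorems 2.23 + 2.25 the other — the form in
which "Definitions 2.1 and 2.6 define the same class of polynomials" is used in §2.5.
[cite: BrandenHuh2019, §2.4 Thm. 2.25 (p. 24); §2.3 Thm. 2.16 (2); §2.5 proof of Thm. 2.30] -/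
theorem mem_lorentzian_iff_forall_sigPos_hessianAt_le_one {f : MvPolynomial σ ℝ} {d : ℕ} :
    f ∈ lorentzian σ d ↔ f.IsHomogeneous d ∧ (∀ α, 0 ≤ coeff α f) ∧
      ∀ α : σ →₀ ℕ, α.degree + 2 ≤ d → ∀ w : σ → ℝ, (∀ k, 0 < w k) →
        sigPos (Matrix.toBilin' (hessianAt (iterPderiv α f) w)).toQuadraticMap ≤ 1 :=
  ⟨fun hf ↦ ⟨isHomogeneous_of_mem_lorentzian hf, coeff_nonneg_of_mem_lorentzian hf, fun _ hα _ hw ↦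
      sigPos_hessianAt_iterPderiv_le_one_of_mem_lorentzian hf hα fun k ↦ (hw k).le⟩,
    fun ⟨h1, h2, h3⟩ ↦ mem_lorentzian_of_forall_sigPos_hessianAt_le_one h1 h2 h3⟩

end Criterion

/-! ## §3 Theorem 2.30, (2) ⟹ (3); Corollary 2.31 -/

section Strongly

/-- **Brändén–Huh, Theorem 2.30, (2) ⟹ (3): a strongly log-concave homogeneous polynomial is Lorentzian** (Hessian
form). Let `f` be homogeneous of degree `d` with nonnegative coefficients such that for every `α` the Hessian of
`log ∂^α f` is negative semidefinite on `ℝ^n_{>0}` wherever `∂^α f > 0` — written `g(w) · xᵀ H_g(w) x ≤ (∇g(w)·x)²`,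
`g = ∂^α f`, for all `w ∈ ℝ^n_{>0}`, `x ∈ ℝ^n` (vacuous where `g(w) = 0`, i.e. where `g = 0`). Then `f ∈ L^d_n`. "By
Proposition 2.33, either `∂^α f` is identically zero or the Hessian of `∂^α f` has exactly one positive eigenvalue on
`ℝ^n_{>0}` for all `α ∈ ℕ^n`. By Proposition 2.17, `f` is `2(1 - 1/d)`-Rayleigh, and hence, by Theorem 2.23, the
support of `f` is M-convex. Therefore, by Theorem 2.25, `f` is Lorentzian." [cite: BrandenHuh2019, §2.5 Thm. 2.30
((2) ⟹ (3)) and its proof (p. 28)] -/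
theorem mem_lorentzian_of_stronglyLogConcave {f : MvPolynomial σ ℝ} {d : ℕ} (hf : f.IsHomogeneous d)
    (hnn : ∀ α, 0 ≤ coeff α f)
    (hslc : ∀ (α : σ →₀ ℕ) (w : σ → ℝ), (∀ k, 0 < w k) → ∀ x : σ → ℝ,
      eval w (iterPderiv α f) * Matrix.toBilin' (hessianAt (iterPderiv α f) w) x x ≤
        (∑ i, x i * eval w (pderiv i (iterPderiv α f))) ^ 2) :
    f ∈ lorentzian σ d := by
  refine mem_lorentzian_of_forall_sigPos_hessianAt_le_one hf hnn fun α hα w hw ↦ ?_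
  obtain ⟨e, he⟩ : ∃ e, d = e + α.degree := ⟨d - α.degree, by omega⟩
  have he2 : 2 ≤ e := by omega
  have hg : (iterPderiv α f).IsHomogeneous e := IsHomogeneous.iterPderiv α (he ▸ hf)
  by_cases hg0 : iterPderiv α f = 0
  · -- `∂^α f` is identically zero: its Hessian vanishes
    have hH : hessianAt (iterPderiv α f) w = 0 := by
      ext i j
      rw [hessianAt_apply, hg0, map_zero, map_zero, map_zero, Matrix.zero_apply]
    rw [hH, map_zero]
    exact sigPos_le_one_of_orthogonal_nonpos (0 : LinearMap.BilinForm ℝ (σ → ℝ)) (w := w) fun z _ ↦ by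
      rw [LinearMap.zero_apply, LinearMap.zero_apply]
  · -- otherwise `∂^α f > 0` on `ℝ^n_{>0}` and Prop. 2.33 (2) ⟹ (3) applies
    exact sigPos_hessianAt_le_one_of_logConcaveAt hg he2
      (eval_pos_of_ne_zero_of_coeff_nonneg hg0 (fun β ↦ coeff_iterPderiv_nonneg hnn α β) hw) (hslc α w hw)

/-- **Theorem 2.30, (2) ⟺ (3), Hessian form**: for a homogeneous `f`, `f ∈ L^d_n` iff `f` has nonnegative
coefficients and every `g = ∂^α f` satisfies `g(w) · xᵀ H_g(w) x ≤ (∇g(w)·x)²` on `ℝ^n_{>0}` (the forward direction,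
even on the closed orthant, is `stronglyLogConcave_of_mem_lorentzian`). [cite: BrandenHuh2019, §2.5 Thm. 2.30
((2) ⟺ (3))] -/
theorem mem_lorentzian_iff_stronglyLogConcave {f : MvPolynomial σ ℝ} {d : ℕ} :
    f ∈ lorentzian σ d ↔ f.IsHomogeneous d ∧ (∀ α, 0 ≤ coeff α f) ∧
      ∀ (α : σ →₀ ℕ) (w : σ → ℝ), (∀ k, 0 < w k) → ∀ x : σ → ℝ,
        eval w (iterPderiv α f) * Matrix.toBilin' (hessianAt (iterPderiv α f) w) x x ≤
          (∑ i, x i * eval w (pderiv i (iterPderiv α f))) ^ 2 :=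
  ⟨fun hf ↦ ⟨isHomogeneous_of_mem_lorentzian hf, coeff_nonneg_of_mem_lorentzian hf, fun α _ hw x ↦
      stronglyLogConcave_of_mem_lorentzian hf α (fun k ↦ (hw k).le) x⟩,
    fun ⟨h1, h2, h3⟩ ↦ mem_lorentzian_of_stronglyLogConcave h1 h2 h3⟩

/-- **Brändén–Huh, Corollary 2.31: "The support of any strongly log-concave homogeneous polynomial is M-convex."**
(Hessian form of strong log-concavity, as above; via Thm. 2.30 (2) ⟹ (3) and `L^d_n ⊆ M^d_n`, answering Gurvits'
question [Gur09, §4.5 (iii)].) [cite: BrandenHuh2019, §2.5 Cor. 2.31 (p. 26)] -/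
theorem isMConvex_support_of_stronglyLogConcave {f : MvPolynomial σ ℝ} {d : ℕ} (hf : f.IsHomogeneous d)
    (hnn : ∀ α, 0 ≤ coeff α f)
    (hslc : ∀ (α : σ →₀ ℕ) (w : σ → ℝ), (∀ k, 0 < w k) → ∀ x : σ → ℝ,
      eval w (iterPderiv α f) * Matrix.toBilin' (hessianAt (iterPderiv α f) w) x x ≤
        (∑ i, x i * eval w (pderiv i (iterPderiv α f))) ^ 2) :
    IsMConvex {α | coeff α f ≠ 0} :=
  isMConvex_support_of_mem_lorentzian (mem_lorentzian_of_stronglyLogConcave hf hnn hslc)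

end Strongly

/-! ## §4 Theorem 2.30, (1) ⟹ (3): completely log-concave homogeneous polynomials are Lorentzian -/

section Completely

/-- **`∂^α` is a product of coordinate directional derivatives**: for every `α` there is a list of `|α|` nonnegative
vectors (the `e_i`, `α_i` times each) with `D_{a_1} ⋯ D_{a_m} f = ∂^α f` ("Clearly, completely log-concave polynomials
are strongly log-concave"). [cite: BrandenHuh2019, §2.5 proof of Thm. 2.30 (p. 28)] -/
theorem exists_foldr_dirDeriv_eq_iterPderiv (α : σ →₀ ℕ) (f : MvPolynomial σ ℝ) :
    ∃ l : List (σ → ℝ), (∀ a ∈ l, ∀ k, 0 ≤ a k) ∧ l.length = α.degree ∧ l.foldr dirDeriv f = iterPderiv α f := by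
  obtain ⟨n, hn⟩ : ∃ n, α.degree = n := ⟨_, rfl⟩
  induction n generalizing α f with
  | zero =>
    rw [Finsupp.degree_eq_zero_iff] at hn
    refine ⟨[], fun a ha ↦ (List.not_mem_nil ha).elim, ?_, ?_⟩
    · rw [hn, map_zero, List.length_nil]
    · rw [hn, iterPderiv_zero, List.foldr_nil]
  | succ n ih =>
    have hα0 : α ≠ 0 := fun h ↦ by
      rw [h, map_zero] at hn
      exact Nat.succ_ne_zero n hn.symm
    obtain ⟨i, hi⟩ := Finsupp.ne_iff.1 hα0
    have hαi : α i ≠ 0 := by simpa using hi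
    have hdeg : (α - Finsupp.single i 1).degree = n := by
      have := degree_sub_single_add_one hαi
      omega
    obtain ⟨l, hl, hlen, hlf⟩ := ih (α - Finsupp.single i 1) (pderiv i f) hdeg
    refine ⟨l ++ [Pi.single i 1], fun a ha ↦ ?_, ?_, ?_⟩
    · rcases List.mem_append.1 ha with ha | ha
      · exact hl a ha
      · rw [List.mem_singleton] at ha
        subst ha
        intro k
        by_cases hk : k = i
        · subst hk; rw [Pi.single_eq_same]; exact zero_le_one
        · rw [Pi.single_eq_of_ne hk]
    · rw [List.length_append, List.length_singleton, hlen]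
      exact degree_sub_single_add_one hαi
    · rw [List.foldr_append, List.foldr_cons, List.foldr_nil, dirDeriv_single, one_smul, hlf,
        ← iterPderiv_add_single', Finsupp.sub_add_single_one_cancel hαi]

omit [DecidableEq σ] in
/-- **More than `d` directional derivatives annihilate a form of degree `d`** (and `m ≤ d` of them leave a form of
degree `d - m`): removes the length guard `m ≤ d` in the Hessian form of complete log-concavity.
[cite: BrandenHuh2019, §2.5 Thm. 2.30 ("`(Π_{i=1}^m D_i) f` is identically zero or …")] -/
theorem foldr_dirDeriv_isHomogeneous_or_eq_zero {f : MvPolynomial σ ℝ} {d : ℕ} (hf : f.IsHomogeneous d)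
    (l : List (σ → ℝ)) :
    (l.length ≤ d → (l.foldr dirDeriv f).IsHomogeneous (d - l.length)) ∧ (d < l.length → l.foldr dirDeriv f = 0) := by
  induction l with
  | nil => exact ⟨fun _ ↦ by simpa using hf, fun h ↦ (Nat.not_lt_zero _ h).elim⟩
  | cons a l ih =>
    obtain ⟨ih1, ih2⟩ := ih
    rw [List.length_cons, List.foldr_cons]
    constructor
    · intro hle
      have h := ih1 (by omega)
      obtain ⟨e, he⟩ : ∃ e, d - l.length = e + 1 := ⟨d - l.length - 1, by omega⟩
      rw [he] at h
      rw [show d - (l.length + 1) = e by omega]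
      exact isHomogeneous_dirDeriv a h
    · intro hlt
      rcases Nat.lt_or_ge d l.length with h | h
      · rw [ih2 h, dirDeriv_def]
        simp
      · -- `l.length = d`: `foldr` is a constant, killed by one more `D_a`
        have h0 : (l.foldr dirDeriv f).IsHomogeneous 0 := by
          have := ih1 h.le
          rwa [show d - l.length = 0 by omega] at this
        have hC := totalDegree_eq_zero_iff_eq_C.1 (Nat.le_zero.1 h0.totalDegree_le)
        rw [hC, dirDeriv_def]
        simp

omit [DecidableEq σ] in
/-- More than `d` directional derivatives annihilate a form of degree `d`. [cite: BrandenHuh2019, §2.5 Thm. 2.30] -/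
theorem foldr_dirDeriv_eq_zero_of_lt {f : MvPolynomial σ ℝ} {d : ℕ} (hf : f.IsHomogeneous d) {l : List (σ → ℝ)}
    (hl : d < l.length) : l.foldr dirDeriv f = 0 :=
  (foldr_dirDeriv_isHomogeneous_or_eq_zero hf l).2 hl

/-- **Theorem 2.30, (3) ⟹ (1) without the length guard**: for `f ∈ L^d_n` and ANY list of nonnegative vectors,
`g = D_{a_1} ⋯ D_{a_m} f` satisfies `g(w) · xᵀ H_g(w) x ≤ (∇g(w)·x)²` on `ℝ^n_{≥0}` (`g = 0` when `m > d`).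
[cite: BrandenHuh2019, §2.5 Thm. 2.30 ((3) ⟹ (1))] -/
theorem completelyLogConcave_of_mem_lorentzian' {d : ℕ} {f : MvPolynomial σ ℝ} (hf : f ∈ lorentzian σ d)
    (l : List (σ → ℝ)) (hl : ∀ a ∈ l, ∀ k, 0 ≤ a k) {w : σ → ℝ} (hw : ∀ k, 0 ≤ w k) (x : σ → ℝ) :
    eval w (l.foldr dirDeriv f) * Matrix.toBilin' (hessianAt (l.foldr dirDeriv f) w) x x ≤
      (∑ i, x i * eval w (pderiv i (l.foldr dirDeriv f))) ^ 2 := by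
  rcases Nat.lt_or_ge d l.length with h | h
  · rw [foldr_dirDeriv_eq_zero_of_lt (isHomogeneous_of_mem_lorentzian hf) h, map_zero, zero_mul]
    exact sq_nonneg _
  · exact completelyLogConcave_of_mem_lorentzian l hl h hf hw x

/-- **Brändén–Huh, Theorem 2.30, (1) ⟹ (3): a completely log-concave homogeneous polynomial is Lorentzian** (Hessian
form: for every list of nonnegative vectors `a_1, …, a_m`, `g = D_{a_1} ⋯ D_{a_m} f` satisfies
`g(w) · xᵀ H_g(w) x ≤ (∇g(w)·x)²` on `ℝ^n_{>0}`). "Clearly, completely log-concave polynomials are strongly log-concave"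
(`∂^α` is a product of the `D_{e_i}`), and (2) ⟹ (3). [cite: BrandenHuh2019, §2.5 Thm. 2.30 ((1) ⟹ (2) ⟹ (3))
(p. 28)] -/
theorem mem_lorentzian_of_completelyLogConcave {f : MvPolynomial σ ℝ} {d : ℕ} (hf : f.IsHomogeneous d)
    (hnn : ∀ α, 0 ≤ coeff α f)
    (hclc : ∀ l : List (σ → ℝ), (∀ a ∈ l, ∀ k, 0 ≤ a k) → ∀ w : σ → ℝ, (∀ k, 0 < w k) → ∀ x : σ → ℝ,
      eval w (l.foldr dirDeriv f) * Matrix.toBilin' (hessianAt (l.foldr dirDeriv f) w) x x ≤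
        (∑ i, x i * eval w (pderiv i (l.foldr dirDeriv f))) ^ 2) :
    f ∈ lorentzian σ d := by
  refine mem_lorentzian_of_stronglyLogConcave hf hnn fun α w hw x ↦ ?_
  obtain ⟨l, hl, -, hlf⟩ := exists_foldr_dirDeriv_eq_iterPderiv α f
  rw [← hlf]
  exact hclc l hl w hw x

/-- **Theorem 2.30, (1) ⟺ (3), Hessian form**: for a homogeneous `f`, `f ∈ L^d_n` iff `f` has nonnegative
coefficients and every `g = D_{a_1} ⋯ D_{a_m} f` (`a_i ∈ ℝ^n_{≥0}`) satisfies `g(w) · xᵀ H_g(w) x ≤ (∇g(w)·x)²` on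
`ℝ^n_{>0}`. [cite: BrandenHuh2019, §2.5 Thm. 2.30 ((1) ⟺ (3))] -/
theorem mem_lorentzian_iff_completelyLogConcave {f : MvPolynomial σ ℝ} {d : ℕ} :
    f ∈ lorentzian σ d ↔ f.IsHomogeneous d ∧ (∀ α, 0 ≤ coeff α f) ∧
      ∀ l : List (σ → ℝ), (∀ a ∈ l, ∀ k, 0 ≤ a k) → ∀ w : σ → ℝ, (∀ k, 0 < w k) → ∀ x : σ → ℝ,
        eval w (l.foldr dirDeriv f) * Matrix.toBilin' (hessianAt (l.foldr dirDeriv f) w) x x ≤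
          (∑ i, x i * eval w (pderiv i (l.foldr dirDeriv f))) ^ 2 :=
  ⟨fun hf ↦ ⟨isHomogeneous_of_mem_lorentzian hf, coeff_nonneg_of_mem_lorentzian hf, fun l hl _ hw x ↦
      completelyLogConcave_of_mem_lorentzian' hf l hl (fun k ↦ (hw k).le) x⟩,
    fun ⟨h1, h2, h3⟩ ↦ mem_lorentzian_of_completelyLogConcave h1 h2 h3⟩

/-- **Theorem 2.30, (1) ⟺ (2)** for homogeneous polynomials with nonnegative coefficients, Hessian forms on `ℝ^n_{>0}`:
complete and strong log-concavity coincide (both being the Lorentzian property). [cite: BrandenHuh2019, §2.5 Thm. 2.30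
((1) ⟺ (2))] -/
theorem completelyLogConcave_iff_stronglyLogConcave {f : MvPolynomial σ ℝ} {d : ℕ} (hf : f.IsHomogeneous d)
    (hnn : ∀ α, 0 ≤ coeff α f) :
    (∀ l : List (σ → ℝ), (∀ a ∈ l, ∀ k, 0 ≤ a k) → ∀ w : σ → ℝ, (∀ k, 0 < w k) → ∀ x : σ → ℝ,
        eval w (l.foldr dirDeriv f) * Matrix.toBilin' (hessianAt (l.foldr dirDeriv f) w) x x ≤
          (∑ i, x i * eval w (pderiv i (l.foldr dirDeriv f))) ^ 2) ↔
      ∀ (α : σ →₀ ℕ) (w : σ → ℝ), (∀ k, 0 < w k) → ∀ x : σ → ℝ,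
        eval w (iterPderiv α f) * Matrix.toBilin' (hessianAt (iterPderiv α f) w) x x ≤
          (∑ i, x i * eval w (pderiv i (iterPderiv α f))) ^ 2 := by
  constructor
  · intro h
    exact (mem_lorentzian_iff_stronglyLogConcave.1 (mem_lorentzian_of_completelyLogConcave hf hnn h)).2.2
  · intro h
    exact (mem_lorentzian_iff_completelyLogConcave.1 (mem_lorentzian_of_stronglyLogConcave hf hnn h)).2.2

end Completely

end Literature.Combinatorics.LorentzianPolynomials

end
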